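import Summits.BirchSwinnertonDyer.BirchSwinnertonDyer.Theorems.ThetaPartnerAtTwoSignedControlAtTwoPlusCyclicOfHonda
import Literature.NumberTheory.EllipticCurves.Sprung2012.LocalTowerTraceProofs
import Literature.NumberTheory.EllipticCurves.PlusMinusPAdicLFunctionProofs
import HarnessLib

/-!
# Kim 2007 Prop. 3.14 for Kobayashi's PLUS points on a `ℤ_p`-tower: `ω⁺_n = T·∏_{1≤2k≤n} Φ_{p^{2k}}(1+T)` ANNIHILATES
# `E⁺(K_n·K_v)` (`T ↦ g − 1`, `g` a local lift of the topological generator) — any `K`, `p`, `κ`, `ι`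

Routes `ResidualThetaTransportAtTwo` (RTT, crux r201 `ResidualLambdaFormulaNegDiscAtTwo`, stmt-BirchSwinnertonDyer-23110) /
`ThetaPartnerAtTwo`. Seat `prover-bsd-wall-tp2-p2x-w3` g13; `--supports stmt-BirchSwinnertonDyer-23110` (brick (d′) of the ISO /
H-PLUSDUAL plan: the ANNIHILATION half of Kim's step (b) «`Ê(m_n) ⊗ ℚ_p/ℤ_p = H_n[ω_n]`»). THEOREMS ONLY (no definition, no named fact,
no instance, no `sorry`); route-independent; closes nothing.

B. D. Kim, Compositio Math. 143 (2007), **Prop. 3.14** (p. 55): «`(ω⁻_n)^ι Ê⁻(m_n) = 0` and `ω⁻_n Ê⁻(m_n) = 0`», proved by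
«`(Φ_n)^ι = 1 + (γ^{-1})^{p^{n−1}} + ⋯` acts as `Tr_{n/n−1}` on `Ê(m_n)`», trace relations, and the torsion-freeness of the layer
quotients. This file proves the PLUS analogue on the tree's objects (Kobayashi's `E⁺(K_n·K_v) = signedLocalPointsOfEmb κ ι W 1 n`:
`Tr_{n/m+1} P ∈ E(K_m·K_v)` for even `m < n`), for every `ℤ_p`-extension `κ` of any field `K`, completion `K_v = E`, and local
`g ∈ Γ_{K_v}` lifting the topological generator (`κ(g|) = 1`), under (NT) «no `p`-torsion in `E(K_∞·K_v)`»: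

* §1 the operator calculus: `Q ↦ Q(σ_g − 1)` for `Q ∈ ℤ[T]` (`Polynomial.aeval` at the endomorphism `σ_g − 1` of `E(K̄_v)`,
  `σ_g = (g • ·)`); **`Φ_{p^{k+1}}(σ_g)` IS the trace `Tr_{k+1/k}` on `E(K_{k+1}·K_v)`** (`aeval_cyclotomic_comp_apply_eq_localTrace`,
  from the tree's `Sprung2012.localTraceOfEmb_succ_eq_sum_pow_smul` and Mathlib's `cyclotomic_prime_pow_eq_geom_sum`);
* §2 **`localTrace_mem_signedLocalPointsOfEmb_one_of_even`**: for `P ∈ E⁺(K_{2j+2}·K_v)`, `Tr_{2j+2/2j+1} P ∈ E⁺(K_{2j}·K_v)` (Kim's first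
  step, plus version: the even condition at `m = 2j` puts the trace in `E(K_{2j}·K_v)`, trace transitivity gives the plus conditions at
  level `2j+1`, and the tree's layer descent `SignedEC.mem_signedLocalPointsOfEmb_of_mem_layer` finishes);
* §3 **`aeval_X_mul_cyclotomicOmegaPlus_apply_eq_zero`**: `(T·ω̃⁺_n)(σ_g − 1) · P = 0` for every `P ∈ E⁺(K_n·K_v)` and every `n`
  (induction over the even layers via the tree's `cyclotomicOmegaPlus_two_mul_add_two`; odd layers collapse by
  `SignedEC.signedLocalPointsOfEmb_one_odd_le` and `cyclotomicOmegaPlus_two_mul_add_one`), with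
  `T·ω̃⁺_n = X * cyclotomicOmegaPlus p n` the tree's half polynomial (`Literature/…/PlusMinusPAdicLFunction`).

HONEST FRAMING: the `ι`-version (`g ↦ g⁻¹`) and the RANK half of (d′) are not in this file; closes nothing; ISO / 23110 NOT proved; BSD is
not proved by any of this.
References: [BDKim2007] Prop. 3.14 (p. 55), Prop. 3.15; [Kobayashi2003] Def. 1.1, §8 (Prop. 8.12); [Pollack2003] §6.5 (`ω_n^±`).
-/

set_option autoImplicit false
-- the Theorems namespace of this sub repeats the summit name by design (D-0017 nested layout)
set_option linter.dupNamespace false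

noncomputable section

open scoped Classical

open Finset Polynomial

namespace Summit.BirchSwinnertonDyer.BirchSwinnertonDyer.Theorems.SignedEC.PlusOmega

open Literature.NumberTheory.EllipticCurves Literature.NumberTheory.GaloisRepresentations
  WeierstrassCurve ZpExtension Literature.NumberTheory.EllipticCurves.Kobayashi2003
  Literature.NumberTheory.EllipticCurves.Sprung2012 Summit.BirchSwinnertonDyer.Rank1Residual.Additive

universe u

variable {K : Type u} [Field K] (W : WeierstrassCurve K) {p : ℕ} [hp : Fact p.Prime] (κ : ZpExtension K p)
  {E : Type u} [Field E] [Algebra K E] (ι : AlgebraicClosure K →ₐ[K] AlgebraicClosure E)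

/-! ## §1 The operator calculus `Q ↦ Q(σ_g − 1)` on `E(K̄_v)` -/

/-- `σ_g^m = σ_{g^m}` as additive endomorphisms of `E(K̄_v)` (`σ_g = (g • ·)`). [folklore] -/
theorem toAddMonoidEnd_pow_apply (g : Field.absoluteGaloisGroup E) (m : ℕ) (P : localPoints W E) :
    ((DistribMulAction.toAddMonoidEnd (Field.absoluteGaloisGroup E) (localPoints W E) g) ^ m) P = g ^ m • P := by
  rw [← map_pow]; rfl

/-- **`Φ_{p^{k+1}}(σ_g)` is the trace `Tr_{k+1/k}` on `E(K_{k+1}·K_v)`**: `Φ_{p^{k+1}}(Y) = ∑_{i<p} (Y^{p^k})^i` (Mathlib) and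
`Tr_{k+1/k} y = ∑_{i<p} g^{p^k i} • y` (`Sprung2012.localTraceOfEmb_succ_eq_sum_pow_smul`). Kim: «`(Φ_n)^ι = 1 + (γ^{-1})^{p^{n−1}} + ⋯`
acts as `Tr_{n/n−1}` on `Ê(m_n)`». Here stated for `Φ_{p^{k+1}}(1+T)` evaluated at `T = σ_g − 1`. [cite: BDKim2007, Prop. 3.14 (proof, p. 55)]
[cite: Kobayashi2003, Def. 1.1] -/
theorem aeval_cyclotomic_comp_apply_eq_localTrace {g : Field.absoluteGaloisGroup E}
    (hg : κ.IsTopGenerator (resGalOfEmb ι g)) (k : ℕ) {y : localPoints W E}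
    (hy : y ∈ localLayerPointsOfEmb κ ι W (k + 1)) :
    Polynomial.aeval ((DistribMulAction.toAddMonoidEnd (Field.absoluteGaloisGroup E) (localPoints W E) g) - 1)
        ((cyclotomic (p ^ (k + 1)) ℤ).comp (X + 1)) y = localTraceOfEmb κ ι W k (k + 1) y := by
  set σ := DistribMulAction.toAddMonoidEnd (Field.absoluteGaloisGroup E) (localPoints W E) g with hσ
  rw [Polynomial.aeval_comp, map_add, Polynomial.aeval_X, map_one, sub_add_cancel,
    cyclotomic_prime_pow_eq_geom_sum hp.out, map_sum, localTraceOfEmb_succ_eq_sum_pow_smul κ ι W hg k hy]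
  rw [show (∑ i ∈ range p, Polynomial.aeval σ (((X : ℤ[X]) ^ p ^ k) ^ i)) y =
      ∑ i ∈ range p, (Polynomial.aeval σ (((X : ℤ[X]) ^ p ^ k) ^ i)) y from AddMonoidHom.finsetSum_apply _ _ _]
  refine Finset.sum_congr rfl fun i _ ↦ ?_
  rw [map_pow, map_pow, Polynomial.aeval_X, ← pow_mul, hσ, toAddMonoidEnd_pow_apply]

/-! ## §2 Kim's first step, plus version: `Tr_{2j+2/2j+1} E⁺(K_{2j+2}·K_v) ⊆ E⁺(K_{2j}·K_v)` -/

/-- **`Tr_{2j+2/2j+1} P ∈ E⁺(K_{2j}·K_v)` for `P ∈ E⁺(K_{2j+2}·K_v)`** (under (NT)): the even condition at `m = 2j` puts the trace in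
`E(K_{2j}·K_v)`; by trace transitivity it satisfies the plus conditions of level `2j+1`; layer descent
(`SignedEC.mem_signedLocalPointsOfEmb_of_mem_layer`) then gives the plus conditions of level `2j`. Kim (minus version): «if `n` is odd,
`Tr_{n/n−1}(Ê⁻(m_n)) ⊂ Ê⁻(m_{n−2})`». [cite: BDKim2007, Prop. 3.14 (proof, p. 55)] [cite: Kobayashi2003, Def. 1.1, Prop. 8.12 (proof)] -/
theorem localTrace_mem_signedLocalPointsOfEmb_one_of_even
    (hnt : ∀ P ∈ localTowerPointsOfEmb κ ι W, p • P = 0 → P = 0) (j : ℕ) {P : localPoints W E}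
    (hP : P ∈ signedLocalPointsOfEmb κ ι W 1 (2 * j + 2)) :
    localTraceOfEmb κ ι W (2 * j + 1) (2 * j + 2) P ∈ signedLocalPointsOfEmb κ ι W 1 (2 * j) := by
  have hP' := (mem_signedLocalPointsOfEmb_one_iff κ ι W (2 * j + 2) P).mp hP
  -- the even condition at `m = 2j`
  have hx2j : localTraceOfEmb κ ι W (2 * j + 1) (2 * j + 2) P ∈ localLayerPointsOfEmb κ ι W (2 * j) :=
    hP'.2 (2 * j) (by omega) (even_two_mul j)
  -- the plus conditions of level `2j+1` by transitivity
  have hx : localTraceOfEmb κ ι W (2 * j + 1) (2 * j + 2) P ∈ signedLocalPointsOfEmb κ ι W 1 (2 * j + 1) := by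
    rw [mem_signedLocalPointsOfEmb_one_iff]
    refine ⟨localTraceOfEmb_mem_of_mem κ ι W (2 * j + 1) (2 * j + 2) hP'.1, fun m hm heven ↦ ?_⟩
    have hPfix : P ∈ localFixedPointsOfEmb ι W (κ.layerSubgroup (2 * j + 2)) := hP'.1
    have htrans := localPairTraceOfEmb_trans ι W (κ.layerSubgroup_antitone (show m + 1 ≤ 2 * j + 1 by omega))
      (κ.layerSubgroup_antitone (show 2 * j + 1 ≤ 2 * j + 2 by omega)) hPfix
    rw [← localTraceOfEmb_eq_localPairTraceOfEmb, ← localTraceOfEmb_eq_localPairTraceOfEmb,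
      ← localTraceOfEmb_eq_localPairTraceOfEmb] at htrans
    rw [← htrans]
    exact hP'.2 m (by omega) heven
  exact SignedEC.mem_signedLocalPointsOfEmb_of_mem_layer W κ ι hnt 1 (by omega) hx hx2j

/-! ## §3 `ω⁺_n` annihilates `E⁺(K_n·K_v)` -/

/-- The even layers: `(T·ω̃⁺_{2j})(σ_g − 1) · P = 0` for `P ∈ E⁺(K_{2j}·K_v)` (induction on `j`: peel off `Φ_{p^{2j}}(σ_g) = Tr_{2j/2j−1}`,
which lands in `E⁺(K_{2j−2}·K_v)`; at the bottom `σ_g − 1` kills `E(K_v)`). [cite: BDKim2007, Prop. 3.14 (proof, p. 55)] -/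
theorem aeval_X_mul_cyclotomicOmegaPlus_apply_eq_zero_even
    (hnt : ∀ P ∈ localTowerPointsOfEmb κ ι W, p • P = 0 → P = 0) {g : Field.absoluteGaloisGroup E}
    (hg : κ.IsTopGenerator (resGalOfEmb ι g)) (j : ℕ) {P : localPoints W E}
    (hP : P ∈ signedLocalPointsOfEmb κ ι W 1 (2 * j)) :
    Polynomial.aeval ((DistribMulAction.toAddMonoidEnd (Field.absoluteGaloisGroup E) (localPoints W E) g) - 1)
        (X * cyclotomicOmegaPlus p (2 * j)) P = 0 := by
  set σ := DistribMulAction.toAddMonoidEnd (Field.absoluteGaloisGroup E) (localPoints W E) g with hσ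
  induction j generalizing P with
  | zero =>
    rw [Nat.mul_zero, cyclotomicOmegaPlus_zero, mul_one, Polynomial.aeval_X]
    rw [Nat.mul_zero, signedLocalPointsOfEmb_zero] at hP
    have hfix := (mem_localLayerPointsOfEmb_zero_iff κ ι W P).mp hP g
    show σ P - P = 0
    rw [sub_eq_zero]; exact hfix
  | succ j ih =>
    have e2 : 2 * (j + 1) = 2 * j + 2 := by ring
    rw [e2] at hP ⊢
    rw [cyclotomicOmegaPlus_two_mul_add_two, ← mul_assoc, map_mul]
    show Polynomial.aeval (σ - 1) (X * cyclotomicOmegaPlus p (2 * j))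
      (Polynomial.aeval (σ - 1) ((cyclotomic (p ^ (2 * j + 2)) ℤ).comp (X + 1)) P) = 0
    rw [show 2 * j + 2 = (2 * j + 1) + 1 by ring,
      aeval_cyclotomic_comp_apply_eq_localTrace W κ ι hg (2 * j + 1) (signedLocalPointsOfEmb_le κ ι W 1 _ hP)]
    exact ih (localTrace_mem_signedLocalPointsOfEmb_one_of_even W κ ι hnt j hP)

/-- **Kim's Prop. 3.14 for PLUS points: `ω⁺_n · E⁺(K_n·K_v) = 0`**, i.e. `(T·ω̃⁺_n)(σ_g − 1) · P = 0` for every `n` and every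
`P ∈ E⁺(K_n·K_v)` (`T·ω̃⁺_n = X * cyclotomicOmegaPlus p n`; `σ_g = (g • ·)` for a local `g` with `κ(g|_{K̄}) = 1`; hypothesis (NT): no
`p`-torsion in `E(K_∞·K_v)`). Odd layers collapse onto the even ones (`E⁺_{2j+1} ≤ E⁺_{2j}`, `ω̃⁺_{2j+1} = ω̃⁺_{2j}`).
[cite: BDKim2007, Prop. 3.14 (p. 55)] [cite: Kobayashi2003, Def. 1.1, Prop. 8.12] [cite: Pollack2003, §6.5] -/
theorem aeval_X_mul_cyclotomicOmegaPlus_apply_eq_zero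
    (hnt : ∀ P ∈ localTowerPointsOfEmb κ ι W, p • P = 0 → P = 0) {g : Field.absoluteGaloisGroup E}
    (hg : κ.IsTopGenerator (resGalOfEmb ι g)) (n : ℕ) {P : localPoints W E}
    (hP : P ∈ signedLocalPointsOfEmb κ ι W 1 n) :
    Polynomial.aeval ((DistribMulAction.toAddMonoidEnd (Field.absoluteGaloisGroup E) (localPoints W E) g) - 1)
        (X * cyclotomicOmegaPlus p n) P = 0 := by
  rcases Nat.even_or_odd n with ⟨j, hj⟩ | ⟨j, hj⟩
  · subst hj
    rw [← two_mul] at hP ⊢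
    exact aeval_X_mul_cyclotomicOmegaPlus_apply_eq_zero_even W κ ι hnt hg j hP
  · subst hj
    rw [cyclotomicOmegaPlus_two_mul_add_one]
    exact aeval_X_mul_cyclotomicOmegaPlus_apply_eq_zero_even W κ ι hnt hg j
      (SignedEC.signedLocalPointsOfEmb_one_odd_le W κ ι hnt j hP)

end Summit.BirchSwinnertonDyer.BirchSwinnertonDyer.Theorems.SignedEC.PlusOmega

end
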